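import Summits.NavierStokesRegularity.OSWSelfSimilar.SheetRPerturbedResolvent
import Summits.NavierStokesRegularity.OSWSelfSimilar.SheetRResolventIdentity
import HarnessLib

/-!
# SHEET-ℝ frame, (P1) for the FULL operator `A = (−∂² + d∂ + V) + K`: the first RESOLVENT IDENTITY for `R_K(σ)`, the pseudo-resolvent
# structure on `Re σ > −m`, and holomorphy — cert-1's «`k` is analytic on `Re σ > −(c₁ + γ)`» input for `A_F = B_λ − P + F`

HONEST FRAMING (cell ns-blowup GROUP B / zone Z3, case Z3-SR-SPEC, PAPER item (P1) and the analyticity clause of SHEET-R-SPEC-PRICE-impl1 §0 (iii)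
(«`k(σ) = θ(v₀, 𝒜(σ)⁻¹Jh)_E` is analytic on `Re σ > −0.249`»); 1-D MODEL certificate frame (viscous gCLM/OSW sheet on the line); not Euler/NS;
«violates: none — MODEL»). Nothing here asserts that a profile exists; the Gårding datum of the perturbed form ((S1)) is the HYPOTHESIS
`GardingDataK`; `K` is an arbitrary bounded real operator `Esp L hL →L[ℝ] W L`.

Verbatim the argument of `SheetRResolventIdentity` with the perturbed objects: the `w`-solution `Φ = R_K(w)G` solves the `z`-system with data
`G + (z − w)Φ` (potential shift; the `∫ w (Kp)φ` terms do not depend on `σ`), perturbed weak uniqueness gives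
`R_K(z)(G + (z − w)Φ) = Φ` (`resolventK_absorb`), hence **`R_K(z) − R_K(w) = (w − z)R_K(z)R_K(w)`** (`resolventK_sub`),
**`IsPseudoResolvent {Re σ > −m} (resolventK hL K h)`** (`isPseudoResolventK`) and `differentiableOn_resolventK`.
Pure functional analysis; no definition, no named fact.  WHAT THIS IS NOT: not NS; not the spectral certificate; no number of record moves.
-/

noncomputable section

namespace Summit.NavierStokesRegularity.OSWSelfSimilar
namespace SheetRPerturbedResolventIdentity

open _root_.MeasureTheory _root_.Set _root_.Filter _root_.Real SheetRWeakProfilePV SheetRWeakToStrong SheetREnergyClass SheetRWeightedMeasure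
  SheetRLinearisedTests SheetREnergySpace SheetRTestSpace SheetRLinearisedFormBounds SheetRSolutionOperator SheetRLinearisedCutoffEnergy
  SheetRResolventPair SheetRComplexPivot SheetRResolventComplex SheetRResolventIdentity SheetRPerturbedUniqueness SheetRPerturbedPair
  SheetRPerturbedResolvent Literature.Analysis.OperatorTheory
open scoped Topology ENNReal

variable {L D₀ D₁ V₀ m : ℝ} {d V : ℝ → ℝ}

/-- **Shift of the potential** (coefficient data from `GardingDataK`): for an energy-class profile and a compactly supported test,
`linForm L d (V + s) u u₁ φ φ₁ = linForm L d V u u₁ φ φ₁ + s·∫ w u φ`. [folklore] -/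
theorem linForm_shiftK {hL : 0 < L} {K : Esp L hL →L[ℝ] W L} (h : GardingDataK L hL d V K D₀ D₁ V₀ m) (s : ℝ) {u u₁ φ φ₁ : ℝ → ℝ}
    (hφ : IsCompactTest φ φ₁) (hum : AEStronglyMeasurable u volume) (hu₁m : AEStronglyMeasurable u₁ volume)
    (h0 : Integrable fun y => (L ^ 2 + y ^ 2) * u y ^ 2) (h1 : Integrable fun y => (L ^ 2 + y ^ 2) * u₁ y ^ 2) :
    Integrable (fun y => (L ^ 2 + y ^ 2) * (u y * φ y)) ∧
      linForm L d (fun ξ => V ξ + s) u u₁ φ φ₁ = linForm L d V u u₁ φ φ₁ + s * ∫ y, (L ^ 2 + y ^ 2) * (u y * φ y) := by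
  obtain ⟨hint, -⟩ := abs_linForm_le hL h.d_meas h.V_meas h.D₁_nonneg h.d_le h.V_le hφ hum hu₁m h0 h1
  obtain ⟨hc, -, -, -⟩ := basic_of_isCompactTest hφ
  have hwφ := (weighted_of_isCompactTest (L := L) hφ).1
  obtain ⟨hi, -⟩ := integral_weight_abs_mul_le (L := L) hum hc.aestronglyMeasurable h0 hwφ
  have huφ : Integrable (fun y => (L ^ 2 + y ^ 2) * (u y * φ y)) := by
    refine hi.mono' ((by fun_prop : AEStronglyMeasurable (fun y : ℝ => L ^ 2 + y ^ 2) volume).mul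
      (hum.mul hc.aestronglyMeasurable)) (Eventually.of_forall fun y => ?_)
    rw [Real.norm_eq_abs, abs_mul, abs_of_nonneg (by positivity : (0:ℝ) ≤ L ^ 2 + y ^ 2)]
  refine ⟨huφ, ?_⟩
  unfold linForm
  rw [← integral_const_mul, ← integral_add hint (huφ.const_mul s)]
  refine integral_congr_ae (Eventually.of_forall fun y => ?_)
  ring

/-- **Absorption** for the perturbed resolvent: `R_K(z)(G + (z − w)R_K(w)G) = R_K(w)G` for `z, w` in the half-plane. [folklore] -/
theorem resolventK_absorb (hL : 0 < L) (K : Esp L hL →L[ℝ] W L) (h : GardingDataK L hL d V K D₀ D₁ V₀ m) {z w : ℂ}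
    (hz : -m < z.re) (hw : -m < w.re) (G : Wc L) :
    resolventK hL K h z (G + (z - w) • resolventK hL K h w G) = resolventK hL K h w G := by
  set Φ := resolventK hL K h w G with hΦ
  obtain ⟨happw, hre, him, hweakw⟩ := resolventK_weak hL K h hw G
  set P := pairOpK hL K h w hw (toPair L G) with hP
  have hsolves : ∀ v v₁ : ℝ → ℝ, IsCompactTest v v₁ →
      linForm L d (fun ξ => V ξ + z.re) (prim (der P.fst)) (der P.fst) v v₁
            + (∫ y, (L ^ 2 + y ^ 2) * (((K P.fst : W L) : ℝ → ℝ) y * v y))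
            - z.im * ∫ y, (L ^ 2 + y ^ 2) * (prim (der P.snd) y * v y) =
          ∫ y, (L ^ 2 + y ^ 2) * ((((toPair L (G + (z - w) • Φ)).fst : W L) : ℝ → ℝ) y * v y) ∧
        linForm L d (fun ξ => V ξ + z.re) (prim (der P.snd)) (der P.snd) v v₁
            + (∫ y, (L ^ 2 + y ^ 2) * (((K P.snd : W L) : ℝ → ℝ) y * v y))
            + z.im * ∫ y, (L ^ 2 + y ^ 2) * (prim (der P.fst) y * v y) =
          ∫ y, (L ^ 2 + y ^ 2) * ((((toPair L (G + (z - w) • Φ)).snd : W L) : ℝ → ℝ) y * v y) := by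
    intro v v₁ hv
    obtain ⟨e1, e2⟩ := hweakw v v₁ hv
    obtain ⟨humR, hu₁mR, h0R, h1R, -, -⟩ := profile_facts hL P.fst
    obtain ⟨humI, hu₁mI, h0I, h1I, -, -⟩ := profile_facts hL P.snd
    obtain ⟨hiR, hzR⟩ := linForm_shiftK h z.re hv humR hu₁mR h0R h1R
    obtain ⟨-, hwR⟩ := linForm_shiftK h w.re hv humR hu₁mR h0R h1R
    obtain ⟨hiI, hzI⟩ := linForm_shiftK h z.re hv humI hu₁mI h0I h1I
    obtain ⟨-, hwI⟩ := linForm_shiftK h w.re hv humI hu₁mI h0I h1I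
    obtain ⟨hdre, hdim⟩ := reW_imW_add_smul_ae hL G Φ (z - w)
    obtain ⟨htf, hts⟩ := toPair_fst_snd (G + (z - w) • Φ)
    have hiG1 := integrable_weight_mul_test hL (reW L G) hv
    have hiG2 := integrable_weight_mul_test hL (imW L G) hv
    have hdat1 : ∫ y, (L ^ 2 + y ^ 2) * ((((toPair L (G + (z - w) • Φ)).fst : W L) : ℝ → ℝ) y * v y) =
        (∫ y, (L ^ 2 + y ^ 2) * (((reW L G : W L) : ℝ → ℝ) y * v y))
          + (z - w).re * (∫ y, (L ^ 2 + y ^ 2) * (prim (der P.fst) y * v y))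
          - (z - w).im * ∫ y, (L ^ 2 + y ^ 2) * (prim (der P.snd) y * v y) := by
      have e : ∫ y, (L ^ 2 + y ^ 2) * ((((toPair L (G + (z - w) • Φ)).fst : W L) : ℝ → ℝ) y * v y) =
          ∫ y, ((L ^ 2 + y ^ 2) * (((reW L G : W L) : ℝ → ℝ) y * v y)
            + (z - w).re * ((L ^ 2 + y ^ 2) * (prim (der P.fst) y * v y))
            - (z - w).im * ((L ^ 2 + y ^ 2) * (prim (der P.snd) y * v y))) := by
        rw [htf]
        refine integral_congr_ae ?_
        filter_upwards [hdre, hre, him] with y hy hyr hyi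
        rw [hy, hyr, hyi]; ring
      have hI12 : Integrable (fun y => (L ^ 2 + y ^ 2) * (((reW L G : W L) : ℝ → ℝ) y * v y)
          + (z - w).re * ((L ^ 2 + y ^ 2) * (prim (der P.fst) y * v y))) := hiG1.add (hiR.const_mul _)
      rw [e, integral_sub hI12 (hiI.const_mul _), integral_add hiG1 (hiR.const_mul _), integral_const_mul, integral_const_mul]
    have hdat2 : ∫ y, (L ^ 2 + y ^ 2) * ((((toPair L (G + (z - w) • Φ)).snd : W L) : ℝ → ℝ) y * v y) =
        (∫ y, (L ^ 2 + y ^ 2) * (((imW L G : W L) : ℝ → ℝ) y * v y))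
          + (z - w).re * (∫ y, (L ^ 2 + y ^ 2) * (prim (der P.snd) y * v y))
          + (z - w).im * ∫ y, (L ^ 2 + y ^ 2) * (prim (der P.fst) y * v y) := by
      have e : ∫ y, (L ^ 2 + y ^ 2) * ((((toPair L (G + (z - w) • Φ)).snd : W L) : ℝ → ℝ) y * v y) =
          ∫ y, ((L ^ 2 + y ^ 2) * (((imW L G : W L) : ℝ → ℝ) y * v y)
            + (z - w).re * ((L ^ 2 + y ^ 2) * (prim (der P.snd) y * v y))
            + (z - w).im * ((L ^ 2 + y ^ 2) * (prim (der P.fst) y * v y))) := by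
        rw [hts]
        refine integral_congr_ae ?_
        filter_upwards [hdim, hre, him] with y hy hyr hyi
        rw [hy, hyr, hyi]; ring
      have hI12 : Integrable (fun y => (L ^ 2 + y ^ 2) * (((imW L G : W L) : ℝ → ℝ) y * v y)
          + (z - w).re * ((L ^ 2 + y ^ 2) * (prim (der P.snd) y * v y))) := hiG2.add (hiI.const_mul _)
      rw [e, integral_add hI12 (hiR.const_mul _), integral_add hiG2 (hiI.const_mul _), integral_const_mul, integral_const_mul]
    rw [hdat1, hdat2, hzR, hzI, Complex.sub_re, Complex.sub_im]
    rw [hwR] at e1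
    rw [hwI] at e2
    constructor
    · linarith
    · linarith
  have huniq := pairOpK_unique hL K h z hz (toPair L (G + (z - w) • Φ)) hsolves
  obtain ⟨happz, -, -, -⟩ := resolventK_weak hL K h hz (G + (z - w) • Φ)
  rw [happz, ← huniq, ← happw]

/-- **First resolvent identity** for the perturbed resolvent. [folklore] -/
theorem resolventK_sub (hL : 0 < L) (K : Esp L hL →L[ℝ] W L) (h : GardingDataK L hL d V K D₀ D₁ V₀ m) {z w : ℂ}
    (hz : -m < z.re) (hw : -m < w.re) (G : Wc L) :
    resolventK hL K h z G - resolventK hL K h w G = (w - z) • resolventK hL K h z (resolventK hL K h w G) := by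
  have hab := resolventK_absorb hL K h hz hw G
  rw [map_add, map_smul] at hab
  have h1 : resolventK hL K h z G = resolventK hL K h w G - (z - w) • resolventK hL K h z (resolventK hL K h w G) :=
    eq_sub_of_add_eq hab
  rw [h1, ← neg_sub z w, neg_smul]
  abel

/-- **`σ ↦ R_K(σ)` is a pseudo-resolvent on `{Re σ > −m}`** (Kato VIII-§1.1 (1.2)). [folklore] -/
theorem isPseudoResolventK (hL : 0 < L) (K : Esp L hL →L[ℝ] W L) (h : GardingDataK L hL d V K D₀ D₁ V₀ m) :
    IsPseudoResolvent {σ : ℂ | -m < σ.re} (resolventK hL K h) := by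
  intro z hz w hw
  refine ContinuousLinearMap.ext fun G => ?_
  show resolventK hL K h z G - resolventK hL K h w G = (w - z) • resolventK hL K h z (resolventK hL K h w G)
  exact resolventK_sub hL K h hz hw G

/-- **Holomorphy** of `σ ↦ R_K(σ)` on the half-plane `{Re σ > −m}`. [folklore] -/
theorem differentiableOn_resolventK (hL : 0 < L) (K : Esp L hL →L[ℝ] W L) (h : GardingDataK L hL d V K D₀ D₁ V₀ m) :
    DifferentiableOn ℂ (resolventK hL K h) {σ : ℂ | -m < σ.re} :=
  (isPseudoResolventK hL K h).differentiableOn (isOpen_halfPlane m)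

/-- The values of the perturbed resolvent commute. [folklore] -/
theorem resolventK_comm (hL : 0 < L) (K : Esp L hL →L[ℝ] W L) (h : GardingDataK L hL d V K D₀ D₁ V₀ m) {z w : ℂ}
    (hz : -m < z.re) (hw : -m < w.re) : resolventK hL K h z * resolventK hL K h w = resolventK hL K h w * resolventK hL K h z :=
  (isPseudoResolventK hL K h).comm hz hw

end SheetRPerturbedResolventIdentity
end Summit.NavierStokesRegularity.OSWSelfSimilar

end
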